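import Mathlib.MeasureTheory.Constructions.Pi
import Mathlib.Analysis.SpecialFunctions.Log.Basic
import Mathlib.Algebra.BigOperators.Fin
import Mathlib.Algebra.BigOperators.Field
import Mathlib.Data.PNat.Basic
import Mathlib.Tactic.FieldSimp
import Mathlib.Tactic.Ring
import Mathlib.Tactic.Positivity
import HarnessLib

/-!
# [IUTchIII] Remark 3.1.1 (ii)–(iv): normalized weights, direct product regions and the
# `E`-weighted measure (abc-iut cell, layer L6, slice [IUTchIII] §3)

S. Mochizuki, *Inter-universal Teichmüller theory III: canonical splittings of the
log-theta-lattice*, kurims manuscript (May 2020) of PRIMS **57** (2021), §3, Remark 3.1.1,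
kurims pp. 93–97 (PRIMS offset ≈ +420). Everything in this file is the *elementary* part of
Remark 3.1.1 — the bookkeeping of the weights with which log-volumes of the direct summands of a
tensor packet are added, and the measure-theoretic device ("`E`-weighted measure") by which such
weighted sums are realised as genuine measures. These are the normalisations quoted by
[IUTchIII] Proposition 3.9 (i), (ii) and by Corollary 3.12 ("procession-normalized mono-analytic
log-volume … cf. Remark 3.1.1, (ii), (iii), (iv)"). Nothing here is disputed mathematics; the
series' bibliographic key nevertheless carries the D-0012 claim status, hence the tag form
[claim: Mochizuki2012, status: disputed] on every declaration.

**Contents.**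
* (ii) the *normalized weight* `1 / ([K_v : (F_mod)_v] · Σ_{w | v_ℚ} [(F_mod)_w : ℚ_{v_ℚ}])` of the
  summand of `log(^α 𝓕_{v_ℚ})` at `v`, and its tensor-packet analogue
  `1 / ((Π_α [K_{v_α} : (F_mod)_{v_α}]) · Σ_{{w_α}} Π_α [(F_mod)_{w_α} : ℚ_{v_ℚ}])`; we PROVE the
  normalisation property printed after each display ("normalized so that multiplication by
  `p_{v_ℚ}` affects log-volumes by addition or subtraction of the quantity `log(p_{v_ℚ})`"):
  `packetWeight_normalized`, `packetWeightTensor_normalized`.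
* (iii) the vocabulary *direct product region* / *direct product pre-region*.
* (iv) the `E`-weighted measure `μ_E(S)` of a Borel set `S ⊆ M_V = Π_v M_v` attached to data
  `(V, E = {E_v}, M = {(M_v, μ_v)})`, defined literally as in the text (the measure, in
  `M_W ≅ M_{E*V}`, of `S_E = (Π_{e ∈ E} S) ∩ M_{E*V}`), and the displayed formula for direct
  product regions `(1/N_E) · μ_E^{log}(S) = Σ_v (1/N_v) · μ_v^{log}(S_v)`, PROVED
  (`weightedMeasure_log_directProduct`).

**Dictionary / design.** The places `v ∈ 𝕍` over a fixed `v_ℚ` and the places `w ∈ 𝕍_mod` over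
`v_ℚ` are identified via the natural bijection `𝕍 ≃ 𝕍_mod` of [IUTchI] Def. 3.1 (e), so both are
modelled by ONE finite index type `W`; the degrees `[(F_mod)_w : ℚ_{v_ℚ}]`, `[K_v : (F_mod)_v]` are
abstract positive integers `degF`, `degKF` (no number fields are needed for the bookkeeping).
Measure spaces in (iii)/(iv) are Mathlib measure spaces; the text's standing convention
("locally compact Hausdorff, countable basis, complete Borel measure", p. 95) is recorded in the
docstrings, and only σ-finiteness (needed for product measures) is assumed in the theorems.
Deliberately NOT here: Remark 3.1.1 (i) (the explicit description `log(^α 𝓕_v) ≅ k̄`, which needs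
the log-shells of [IUTchIII] Def. 1.1 — typed with Proposition 3.1 in `TensorPackets.lean`), and
the "radial portion" convention for complex archimedean tensor products (p. 96), recorded only in
the docstring of `weightedMeasure`.
-/

namespace Literature.IUT.LogThetaLattice

open Finset MeasureTheory

/-! ### Remark 3.1.1 (ii): normalized weights -/

section Weights

variable {W : Type*} [Fintype W]

/-- The **normalized weight** of the direct summand at `v` of the 1-tensor packet
`log(^α 𝓕_{v_ℚ}) = ⊕_{v | v_ℚ} log(^α 𝓕_v)` ([IUTchIII] Remark 3.1.1 (ii), first display, p. 94):
`1 / ( [K_v : (F_mod)_v] · Σ_{𝕍_mod ∋ w | v_ℚ} [(F_mod)_w : ℚ_{v_ℚ}] )`.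
Here `W` indexes the places of `F_mod` over `v_ℚ` (equivalently, via `𝕍 ≃ 𝕍_mod`, the places of
`𝕍` over `v_ℚ`), `degF w = [(F_mod)_w : ℚ_{v_ℚ}]` and `degKF w = [K_v : (F_mod)_v]` for the `v ∈ 𝕍`
over `w`. [claim: Mochizuki2012, status: disputed] -/
noncomputable def packetWeight (degF degKF : W → ℕ+) (w : W) : ℝ :=
  1 / ((degKF w : ℝ) * ∑ w', (degF w' : ℝ))

/-- The **normalized weight** of the direct summand of the `n`-tensor packet `log(^A 𝓕_{v_ℚ})`
indexed by a collection `{v_α}_{α ∈ A}` of places over `v_ℚ` ([IUTchIII] Remark 3.1.1 (ii), third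
display, p. 94):
`1 / ( (Π_{α∈A} [K_{v_α} : (F_mod)_{v_α}]) · Σ_{{w_α}_{α∈A}} Π_{α∈A} [(F_mod)_{w_α} : ℚ_{v_ℚ}] )`,
the sum ranging over all collections `{w_α}_{α ∈ A}` of (not necessarily distinct) places over
`v_ℚ`. [claim: Mochizuki2012, status: disputed] -/
noncomputable def packetWeightTensor {A : Type*} [Fintype A] [DecidableEq A] (degF degKF : W → ℕ+)
    (wA : A → W) : ℝ :=
  1 / ((∏ a, (degKF (wA a) : ℝ)) * ∑ w' : A → W, ∏ a, (degF (w' a) : ℝ))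

/-- The unnormalized weight of Remark 3.1.1 (ii) (second display, p. 94): log-volumes on the
portion of `log(^A 𝓕_{v_ℚ})` corresponding to `⊗_α K_{v_α}` are considered "relative to the weight
`1 / Π_{α∈A} [K_{v_α} : (F_mod)_{v_α}]`" (for a single place, `1/[K_v : (F_mod)_v]`, first
paragraph of (ii)). [claim: Mochizuki2012, status: disputed] -/
noncomputable def packetWeightRaw {A : Type*} [Fintype A] (degKF : W → ℕ+) (wA : A → W) : ℝ :=
  1 / ∏ a, (degKF (wA a) : ℝ)

omit [Fintype W] in
/-- Positive naturals cast to positive reals. [folklore] -/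
private lemma pnat_cast_pos (n : ℕ+) : (0 : ℝ) < (n : ℝ) := by
  exact_mod_cast n.pos

variable [Nonempty W]

/-- A nonempty sum of positive degrees is positive. [folklore] -/
private lemma sum_degF_pos (degF : W → ℕ+) : (0 : ℝ) < ∑ w', (degF w' : ℝ) :=
  Finset.sum_pos (fun w _ => pnat_cast_pos (degF w)) Finset.univ_nonempty

/-- **Normalisation of the weights** ([IUTchIII] Remark 3.1.1 (ii), p. 94: "normalized so that
multiplication by `p_{v_ℚ}` affects log-volumes by addition or subtraction … of the quantity
`log(p_{v_ℚ}) ∈ ℝ`"). If in the summand at each `v | v_ℚ` the log-volume changes by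
`[K_v : ℚ_{v_ℚ}] · c = [K_v : (F_mod)_v] · [(F_mod)_v : ℚ_{v_ℚ}] · c` (the effect of multiplication
by `p_{v_ℚ}` on a `[K_v : ℚ_{v_ℚ}]`-dimensional `ℚ_{v_ℚ}`-space, `c = ± log p_{v_ℚ}`), then the
weighted sum over all `v | v_ℚ` changes by exactly `c`. [claim: Mochizuki2012, status: disputed] -/
theorem packetWeight_normalized (degF degKF : W → ℕ+) (c : ℝ) :
    ∑ w, packetWeight degF degKF w * (((degKF w : ℝ) * (degF w : ℝ)) * c) = c := by
  have hS := sum_degF_pos degF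
  have h : ∀ w, packetWeight degF degKF w * (((degKF w : ℝ) * (degF w : ℝ)) * c)
      = (degF w : ℝ) * c / ∑ w', (degF w' : ℝ) := by
    intro w
    have hk := pnat_cast_pos (degKF w)
    unfold packetWeight
    field_simp
  simp_rw [h, ← Finset.sum_div, ← Finset.sum_mul]
  field_simp

/-- **Normalisation of the tensor-packet weights** ([IUTchIII] Remark 3.1.1 (ii), p. 94–95:
"these normalized weights are normalized so that multiplication by `p_{v_ℚ}` affects log-volumes
by addition or subtraction … of the quantity `log(p_{v_ℚ}) ∈ ℝ`"). If in the summand indexed by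
`{v_α}` the log-volume changes by `(Π_α [K_{v_α} : ℚ_{v_ℚ}]) · c`, then the weighted sum over all
collections `{v_α}_{α∈A}` changes by exactly `c`. [claim: Mochizuki2012, status: disputed] -/
theorem packetWeightTensor_normalized {A : Type*} [Fintype A] [DecidableEq A]
    (degF degKF : W → ℕ+) (c : ℝ) :
    ∑ wA : A → W, packetWeightTensor degF degKF wA *
        ((∏ a, ((degKF (wA a) : ℝ) * (degF (wA a) : ℝ))) * c) = c := by
  set S : ℝ := ∑ w' : A → W, ∏ a, (degF (w' a) : ℝ) with hSdef
  have hS : 0 < S :=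
    Finset.sum_pos (fun w _ => Finset.prod_pos fun a _ => pnat_cast_pos (degF (w a)))
      Finset.univ_nonempty
  have h : ∀ wA : A → W, packetWeightTensor degF degKF wA *
      ((∏ a, ((degKF (wA a) : ℝ) * (degF (wA a) : ℝ))) * c)
      = (∏ a, (degF (wA a) : ℝ)) * c / S := by
    intro wA
    have hk : (0 : ℝ) < ∏ a, (degKF (wA a) : ℝ) :=
      Finset.prod_pos fun a _ => pnat_cast_pos (degKF (wA a))
    unfold packetWeightTensor
    rw [← hSdef, Finset.prod_mul_distrib]
    field_simp
  simp_rw [h, ← Finset.sum_div, ← Finset.sum_mul, ← hSdef]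
  field_simp

omit [Nonempty W] in
/-- The sum in the denominator of `packetWeightTensor` factors: `Σ_{{w_α}} Π_α [(F_mod)_{w_α} : ℚ]
= (Σ_w [(F_mod)_w : ℚ])^{#A}` (elementary; implicit in Remark 3.1.1 (ii), p. 94).
[claim: Mochizuki2012, status: disputed] -/
theorem sum_prod_degF_eq_pow {A : Type*} [Fintype A] [DecidableEq A] (degF : W → ℕ+) :
    ∑ w' : A → W, ∏ a, (degF (w' a) : ℝ) = (∑ w, (degF w : ℝ)) ^ Fintype.card A := by
  rw [← Fintype.prod_sum (fun (_ : A) (w : W) => (degF w : ℝ)), Finset.prod_const,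
    Finset.card_univ]

end Weights

/-! ### Remark 3.1.1 (iii): direct product regions -/

section Regions

variable {V : Type*} {M : V → Type*} [∀ v, TopologicalSpace (M v)] [∀ v, MeasurableSpace (M v)]

/-- A **direct product region** ([IUTchIII] Remark 3.1.1 (iii), p. 95): a subset of a finite
direct sum/product `Π_v M_v` of "measure spaces" (in the text's standing sense: locally compact
Hausdorff spaces with a countable basis, equipped with a complete Borel measure, p. 95) "that
arises as a direct product of compact subsets of positive measure in each of the direct
summands". [claim: Mochizuki2012, status: disputed] -/
def IsDirectProductRegion (μ : ∀ v, Measure (M v)) (S : Set (∀ v, M v)) : Prop :=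
  ∃ T : ∀ v, Set (M v), S = Set.univ.pi T ∧ ∀ v, IsCompact (T v) ∧ 0 < μ v (T v)

/-- A **direct product pre-region** ([IUTchIII] Remark 3.1.1 (iii), p. 95): a subset of
`Π_v M_v` "that arises as a direct product of relatively compact subsets in each of the direct
summands". [claim: Mochizuki2012, status: disputed] -/
def IsDirectProductPreRegion (S : Set (∀ v, M v)) : Prop :=
  ∃ T : ∀ v, Set (M v), S = Set.univ.pi T ∧ ∀ v, IsCompact (closure (T v))

/-- A direct product region is a direct product pre-region (Remark 3.1.1 (iii), p. 95: compact
sets are relatively compact). [claim: Mochizuki2012, status: disputed] -/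
theorem IsDirectProductRegion.isDirectProductPreRegion [∀ v, T2Space (M v)]
    {μ : ∀ v, Measure (M v)} {S : Set (∀ v, M v)} (h : IsDirectProductRegion μ S) :
    IsDirectProductPreRegion S := by
  obtain ⟨T, rfl, hT⟩ := h
  exact ⟨T, rfl, fun v => by rw [(hT v).1.isClosed.closure_eq]; exact (hT v).1⟩

end Regions

/-! ### Remark 3.1.1 (iv): the `E`-weighted measure -/

section WeightedMeasure

variable {V : Type*} [Fintype V] [DecidableEq V]
variable (E : V → Type*) [∀ v, Fintype (E v)]

/-- `E_{≠v} := Π_{V ∋ v' ≠ v} E_{v'}` ([IUTchIII] Remark 3.1.1 (iv), p. 96).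
[claim: Mochizuki2012, status: disputed] -/
abbrev ERest (v : V) : Type _ := ∀ v' : {v' : V // v' ≠ v}, E v'

/-- The index set `W := ∐_{v' ∈ V} E_{≠v'} × {v'}` of [IUTchIII] Remark 3.1.1 (iv), p. 96
(second arrow `W ↠ V` = first projection), modelled as a Σ-type.
[claim: Mochizuki2012, status: disputed] -/
abbrev WIndex : Type _ := Σ v : V, ERest E v

/-- The natural projection `E := Π_{v'} E_{v'} ↠ E_{≠v}` (Remark 3.1.1 (iv), p. 96: the first arrow
`E × V ↠ W` "restricts to the natural projection `E × {v'} ↠ E_{≠v'} × {v'}`").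
[claim: Mochizuki2012, status: disputed] -/
def restrictNe (v : V) (e : ∀ v', E v') : ERest E v := fun v' => e v'.1

variable (M : V → Type*) [∀ v, MeasurableSpace (M v)]

/-- The bijection `M_W ≃ M_{E*V} (⊆ M_{E×V} = Π_{(e,v)} M_v)` of [IUTchIII] Remark 3.1.1 (iv),
p. 96 ("the map induced by the various natural projections `E ↠ E_{≠v}`"), written as the map
`M_W → M_{E×V}`, `n ↦ ((e, v) ↦ n_{(v, e|_{≠v})})`; its image is exactly
`M_{E*V} = { {m_{e,v}} | m_{e',v} = m_{e'',v} whenever e', e'' agree off v }`.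
[claim: Mochizuki2012, status: disputed] -/
def unglue (n : ∀ w : WIndex E, M w.1) (e : ∀ v', E v') (v : V) : M v :=
  n ⟨v, restrictNe E v e⟩

/-- `S_E := (Π_{e ∈ E} S) ∩ M_{E*V}`, transported to `M_W` ([IUTchIII] Remark 3.1.1 (iv), p. 97):
the set of `n ∈ M_W` all of whose "`E`-indexed copies" `(v ↦ n_{(v, e|_{≠v})})`, `e ∈ E`, lie in
`S ⊆ M_V`. [claim: Mochizuki2012, status: disputed] -/
def weightedMeasureSet (S : Set (∀ v, M v)) : Set (∀ w : WIndex E, M w.1) :=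
  {n | ∀ e : (∀ v', E v'), (fun v => unglue E M n e v) ∈ S}

/-- The **`E`-weighted measure** `μ_E(S) ∈ ℝ_{≥0} ∪ {+∞}` of a Borel set `S ⊆ M_V` ([IUTchIII]
Remark 3.1.1 (iv), p. 97): "the measure, relative to the [product] measure space structure of
`M_{E*V} (≅ M_W)`, of `S_E`". In the application of Remark 3.1.1 (iii) (p. 95–96), `V` is
`Π_{α∈A} 𝕍_{v_ℚ}`, `N_v = #E_v` is `Π_α [K_{v_α} : (F_mod)_{v_α}]`, and `M_v` is the (radial, at
archimedean `v_ℚ`) portion of the tensor-packet summand indexed by `{v_α}`; the text notes that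
`μ_E` depends only on the cardinalities `N = {N_v}` ("completely determined by … `(V, N, M)`").
[claim: Mochizuki2012, status: disputed] -/
noncomputable def weightedMeasure (μ : ∀ v, Measure (M v)) (S : Set (∀ v, M v)) : ENNReal :=
  Measure.pi (fun w : WIndex E => μ w.1) (weightedMeasureSet E M S)

variable {E M}

omit [Fintype V] [∀ v, Fintype (E v)] [∀ v, MeasurableSpace (M v)] in
/-- For a direct product `S = Π_v S_v` (and all `E_v ≠ ∅`), `S_E ⊆ M_W` is the box
`Π_{w ∈ W} S_{v(w)}` (the computation behind the last display of Remark 3.1.1 (iv), p. 97).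
[claim: Mochizuki2012, status: disputed] -/
theorem weightedMeasureSet_pi [∀ v, Nonempty (E v)] (T : ∀ v, Set (M v)) :
    weightedMeasureSet E M (Set.univ.pi T) = Set.univ.pi (fun w : WIndex E => T w.1) := by
  ext n
  simp only [weightedMeasureSet, Set.mem_setOf_eq, Set.mem_univ_pi, unglue]
  constructor
  · rintro h ⟨v, eb⟩
    classical
    let e : ∀ v', E v' := fun v' => if hv : v' = v then hv ▸ Classical.arbitrary (E v)
      else eb ⟨v', hv⟩
    have he : restrictNe E v e = eb := by
      funext v'
      simp only [restrictNe, e, dif_neg v'.2]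
    have h' := h e v
    rwa [he] at h'
  · intro h e v
    exact h ⟨v, restrictNe E v e⟩

/-- `#E_{≠v} · N_v = N_E := Π_{v'} N_{v'}` where `N_v = #E_v` (Remark 3.1.1 (iv), p. 97).
[claim: Mochizuki2012, status: disputed] -/
theorem card_ERest_mul (v : V) :
    Fintype.card (ERest E v) * Fintype.card (E v) = ∏ v', Fintype.card (E v') := by
  rw [Fintype.card_pi, ← Finset.prod_erase_mul _ _ (Finset.mem_univ v)]
  congr 1
  exact (Finset.prod_subtype (Finset.univ.erase v) (p := fun v' => v' ≠ v) (by simp)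
    (fun v' => Fintype.card (E v'))).symm

/-- `μ_E(Π_v S_v) = Π_v μ_v(S_v)^{#E_{≠v}}` (the "straightforward computation" of Remark 3.1.1
(iv), p. 97, before taking logarithms). [claim: Mochizuki2012, status: disputed] -/
theorem weightedMeasure_pi [∀ v, Nonempty (E v)] (μ : ∀ v, Measure (M v))
    [∀ v, SigmaFinite (μ v)] (T : ∀ v, Set (M v)) :
    weightedMeasure E M μ (Set.univ.pi T) = ∏ v, (μ v (T v)) ^ Fintype.card (ERest E v) := by
  rw [weightedMeasure, weightedMeasureSet_pi, Measure.pi_pi]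
  rw [Fintype.prod_sigma' (fun (v : V) (_ : ERest E v) => μ v (T v))]
  simp [Finset.prod_const, Finset.card_univ]

/-- **The displayed formula of [IUTchIII] Remark 3.1.1 (iv)** (p. 97): for a direct product region
`S = Π_{v∈V} S_v` (each `S_v` of finite positive measure),
`(1/N_E) · μ_E^{log}(S) = Σ_{v∈V} (1/N_v) · μ_v^{log}(S_v)`, where `N_v = #E_v`,
`N_E = Π_v N_v`, and `(-)^{log}` is the natural logarithm. [claim: Mochizuki2012, status: disputed] -/
theorem weightedMeasure_log_directProduct [∀ v, Nonempty (E v)] (μ : ∀ v, Measure (M v))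
    [∀ v, SigmaFinite (μ v)] (T : ∀ v, Set (M v)) (hpos : ∀ v, μ v (T v) ≠ 0)
    (hfin : ∀ v, μ v (T v) ≠ ⊤) :
    (1 / ∏ v, (Fintype.card (E v) : ℝ)) * Real.log (weightedMeasure E M μ (Set.univ.pi T)).toReal
      = ∑ v, (1 / (Fintype.card (E v) : ℝ)) * Real.log (μ v (T v)).toReal := by
  rw [weightedMeasure_pi, ENNReal.toReal_prod, Real.log_prod]
  · rw [Finset.mul_sum]
    refine Finset.sum_congr rfl fun v _ => ?_
    rw [ENNReal.toReal_pow, Real.log_pow]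
    have hN : (Fintype.card (ERest E v) : ℝ) * (Fintype.card (E v) : ℝ)
        = ∏ v', (Fintype.card (E v') : ℝ) := by
      exact_mod_cast card_ERest_mul (E := E) v
    have hEv : (0 : ℝ) < Fintype.card (E v) := by exact_mod_cast Fintype.card_pos
    rw [← hN]
    field_simp
  · intro v _
    rw [ENNReal.toReal_pow]
    exact pow_ne_zero _ (ENNReal.toReal_ne_zero.mpr ⟨hpos v, hfin v⟩)

end WeightedMeasure

end Literature.IUT.LogThetaLattice
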